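import Summits.QuantumFields.YangMills.Theorems.BalabanLadderUVSeamRecResponseMomentsRecentring
import Summits.QuantumFields.YangMills.Theorems.BalabanLadderNTBoundaryLawStrongCoupling
import HarnessLib

/-!
# Crux `UVSeamRec` (stmt-QuantumFields-20043), v5(α) stub `stub_responseMomentsOdd6` (RM): the BODY of the response-moment
# binder holds UNCONDITIONALLY at strong coupling — with the reference values pinned to the infinite-volume plaquette mean

Helper file (`--supports stmt-QuantumFields-20043`) of the stub-helper seat `ym-20043-seam-s2` (lane S-A, gen 2); sequel of
`…ResponseMomentsPinning.lean` / `…ResponseMomentsRecentring.lean`.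

The registered binder (RM) = `ResponseMomentsDefs.ResponseMomentsOdd6SU2` asks, after its window clause (`a ≤ c·uRec`
eventually) and for `β ≥ β₁`, for β-UNIFORM joint exponential moments of the radius-`R+1` cube-kernel responses about
reference values `p q β` that depend on NEITHER the torus side NOR the radius, bounded by `P₀`, on every odd torus, for every
index set `T`.  This file proves that this quantifier structure is inhabited by the actual Wilson state in the
HIGH-TEMPERATURE regime `|β| < β₀(G, r)` (every compact metrisable `G`, every lattice representation `r`):

* §1 `abs_kerE_sub_kerE_plane_le_smallBeta` — the Dobrushin–Shlosman oscillation bound of the NT line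
  (`BoundaryLaw.bl6osc_smallBeta`, p529847) on the radius-`R+1` cubes: any two exteriors' responses differ by `≤ C/R⁴`;
  `abs_kerE_sub_torusE_plane_le_smallBeta` — hence EVERY exterior's response is within `C/R⁴` of the torus mean (torus DLR);
  `abs_torusE_plane_sub_torusE_plane_zero_le_smallBeta` — plaquette means on two odd tori (`R+2 ≤ L, L'`, any site vs the
  origin) differ by `≤ 2C/R⁴` (translation covariance of the kernels, `BoundaryLaw.kerE_plane_centred_eq`).
* §2 **`exists_tendsto_torusE_plane_smallBeta`** — for `|β| < β₀` the plaquette means `⟨plane q x⟩_{2L+1,β}` CONVERGE as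
  `L → ∞` along the odd tori, to a site-independent limit `P q`, at rate `|⟨plane q x⟩_{2L+1,β} − P q| ≤ 2C/R⁴` for
  `R+2 ≤ L` (Cauchy in the volume; `ℝ` complete) — the infinite-volume plaquette expectation at high temperature, with
  `|P q| ≤ sup|plane|`.
* §3 **`responseMoments_body_smallBeta`** — for every `C₁ > 0` there are `β₀ > 0`, `B`, `P₀` and reference values
  `p q β` (:= the infinite-volume mean for `|β| < β₀`, `0` elsewhere; `|p| ≤ P₀`) such that for `|β| < β₀`, on EVERY odd torus
  with `4R+8 ≤ L`, `1 ≤ R`, for every family of orientations/sites (no separation needed) and every `T`: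
  `⟨exp(Σ_{i∈T} (R⁴/C₁)|kerE_{cube i}(plane_i) − p (q i) β|)⟩_{2L+1,β} ≤ exp(B·#T)`, `B = 3C/C₁` — the body of (RM) VERBATIM
  with «`|β| < β₀`» for «`β ≥ β₁`» and no unit guard; §4 `responseMomentsOdd6SU2_body_smallBeta` — the same read at
  `SU(2)`, fundamental representation, Borel structure (the registered stub's group and representation).

So the currency of the v5(α) stub — `L`-independent bounded reference values, all odd sides, all index sets, uniform `B` —
is satisfiable by the lattice Yang–Mills measure in one regime (ceilings-p2's p533459 did the same for the `MomentBounds6`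
body).  HONEST FRAMING: a format rung at HIGH temperature; it says nothing about `β → ∞`, the window clause, E0′, the seam or
the gap; not Clay.

References: R. L. Dobrushin, S. B. Shlosman, in *Statistical Physics and Dynamical Systems* (1985) §2 and H.-O. Georgii,
*Gibbs Measures and Phase Transitions* (2011) Thm. 8.20 / §8.1 (high-temperature uniqueness and mixing — via p529847);
Georgii Thm. 4.17 (DLR consistency); K. Osterwalder, E. Seiler, Ann. Phys. 110 (1978) §4 (strong-coupling regime).
-/

set_option autoImplicit false

noncomputable section

open MeasureTheory Filter Topology Finset
open Literature.MathematicalPhysics.QuantumFieldTheory (GaugeConfig wilsonMeasure isProbabilityMeasure_wilsonMeasure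
  LatticeRep)
open Literature.MathematicalPhysics.QuantumLattice
open Literature.Probability.LatticeModels
open Summit.QuantumFields.YangMills.Cruxes.OSLegsFromFemtoAndGap.DlrCollarTransfer
open Summit.QuantumFields.YangMills.Cruxes.UVSeamRec.TemperedResponse (continuous_kerE_plane abs_kerE_plane_le)
open Summit.QuantumFields.YangMills.Cruxes.NT.BoundaryLaw (bl6osc_smallBeta kerE_plane_centred_eq)

namespace Summit.QuantumFields.YangMills.Cruxes.UVSeamRec.ResponsePinning

variable {G : Type} [Group G] [TopologicalSpace G] [IsTopologicalGroup G] [CompactSpace G]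
  [MeasurableSpace G] [BorelSpace G] (r : LatticeRep G)

/-! ## §1 Strong coupling: every exterior responds within `C/R⁴` of the torus mean -/

section KernelSide

/-- Translation covariance of the radius-`R+1` response kernel: the kernel mean of `plane q x` in the cube around `x`
with exterior `U` is the kernel mean of `plane q 0` in the cube around the origin with the translated exterior.
[folklore] -/
theorem kerE_plane_succ_centred_eq (β : ℝ) (q : Fin 4 × Fin 4) (x : Fin 4 → ℤ) (R : ℕ) (U : LGConfig 4 G) :
    kerE G r β (fun k => x k - (R + 1)) (2 * R + 3) U (plane G r q x) =
      kerE G r β (fun k => (0 : Fin 4 → ℤ) k - (R + 1)) (2 * R + 3) (configShift (-x) U) (plane G r q 0) := by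
  have h := kerE_plane_centred_eq G r β q x (R + 1) U
  have e1 : (fun j : Fin 4 => x j - ((R + 1 : ℕ) : ℤ)) = fun k => x k - (R + 1) := funext fun _ => by push_cast; ring
  have e2 : 2 * (R + 1) + 1 = 2 * R + 3 := by ring
  have e3 : (fun _ : Fin 4 => -((R + 1 : ℕ) : ℤ)) = fun k => (0 : Fin 4 → ℤ) k - (R + 1) := funext fun _ => by
    push_cast; simp
  rw [e1, e2, e3] at h
  exact h

/-- **Strong-coupling oscillation of the response kernel.**  There are `β₀ > 0` and `C ≥ 0` (depending on `G, r`) such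
that for `|β| < β₀`, every orientation, site and radius `R ≥ 1`, any two exteriors' radius-`R+1` cube-kernel means of the
single-plane field differ by at most `C/R⁴` (p529847 `bl6osc_smallBeta` at the centre, which has depth `R+2`).
[cite: DobrushinShlosman1985, §2] (via p529847) -/
theorem abs_kerE_sub_kerE_plane_le_smallBeta :
    ∃ β₀ : ℝ, 0 < β₀ ∧ ∃ C : ℝ, 0 ≤ C ∧ ∀ β : ℝ, |β| < β₀ →
      ∀ (q : Fin 4 × Fin 4) (x : Fin 4 → ℤ) (R : ℕ), 1 ≤ R → ∀ η η' : LGConfig 4 G,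
        |kerE G r β (fun k => x k - (R + 1)) (2 * R + 3) η (plane G r q x) -
          kerE G r β (fun k => x k - (R + 1)) (2 * R + 3) η' (plane G r q x)| ≤ C / (R : ℝ) ^ 4 := by
  obtain ⟨β₀, hβ₀, C, hC, H⟩ := bl6osc_smallBeta G r
  refine ⟨β₀, hβ₀, C, hC, fun β hβ q x R hR η η' => ?_⟩
  have hd : 1 ≤ depth (fun k => x k - (R + 1)) (2 * R + 3) x := by rw [depth_centred]; omega
  refine (H β hβ q _ _ η η' x hd).trans ?_
  rw [depth_centred]
  have hR0 : (0 : ℝ) < R := by exact_mod_cast (show 0 < R by omega)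
  refine div_le_div_of_nonneg_left hC (by positivity) ?_
  have h1 : (R : ℝ) ≤ ((R + 2 : ℕ) : ℝ) := by push_cast; linarith
  gcongr

/-- **Every exterior responds within `C/R⁴` of the torus mean (strong coupling).**  For `|β| < β₀`, `1 ≤ R`, `R + 2 ≤ L`
and every exterior `η`: `|kerE_{x−(R+1),2R+3}(plane q x)(η) − ⟨plane q x⟩_{2L+1,β}| ≤ C/R⁴` — the torus mean is the torus
average of the kernel means (DLR), each within `C/R⁴` of `kerE(η)`. [folklore: Georgii (2011) Thm. 4.17] -/
theorem abs_kerE_sub_torusE_plane_le_smallBeta :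
    ∃ β₀ : ℝ, 0 < β₀ ∧ ∃ C : ℝ, 0 ≤ C ∧ ∀ β : ℝ, |β| < β₀ →
      ∀ (q : Fin 4 × Fin 4) (x : Fin 4 → ℤ) (R L : ℕ), 1 ≤ R → R + 2 ≤ L → ∀ η : LGConfig 4 G,
        |kerE G r β (fun k => x k - (R + 1)) (2 * R + 3) η (plane G r q x) - torusE G r β L (plane G r q x)| ≤
          C / (R : ℝ) ^ 4 := by
  obtain ⟨β₀, hβ₀, C, hC, H⟩ := abs_kerE_sub_kerE_plane_le_smallBeta r
  refine ⟨β₀, hβ₀, C, hC, fun β hβ q x R L hR hRL η => ?_⟩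
  rw [torusE_plane_eq_torusE_kerE r β q x R L hRL, abs_sub_comm]
  exact abs_torusE_sub_le_of_forall r β L (continuous_kerE_plane r β _ _ q x) fun U => H β hβ q x R hR U η

/-- **Finite-size insensitivity at strong coupling (site versus origin).**  For `|β| < β₀`, `1 ≤ R` and two odd tori with
`R + 2 ≤ L, L'`: `|⟨plane q x⟩_{2L+1,β} − ⟨plane q 0⟩_{2L'+1,β}| ≤ 2C/R⁴` — both are within `C/R⁴` of one and the same kernel
value (translation covariance `kerE_plane_succ_centred_eq`). [folklore] -/
theorem abs_torusE_plane_sub_torusE_plane_zero_le_smallBeta :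
    ∃ β₀ : ℝ, 0 < β₀ ∧ ∃ C : ℝ, 0 ≤ C ∧ ∀ β : ℝ, |β| < β₀ →
      ∀ (q : Fin 4 × Fin 4) (x : Fin 4 → ℤ) (R L L' : ℕ), 1 ≤ R → R + 2 ≤ L → R + 2 ≤ L' →
        |torusE G r β L (plane G r q x) - torusE G r β L' (plane G r q 0)| ≤ 2 * C / (R : ℝ) ^ 4 := by
  obtain ⟨β₀, hβ₀, C, hC, H⟩ := abs_kerE_sub_torusE_plane_le_smallBeta r
  refine ⟨β₀, hβ₀, C, hC, fun β hβ q x R L L' hR hL hL' => ?_⟩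
  set η : LGConfig 4 G := fun _ => 1 with hη
  have h1 := H β hβ q x R L hR hL η
  have h2 := H β hβ q 0 R L' hR hL' (configShift (-x) η)
  rw [← kerE_plane_succ_centred_eq r β q x R η] at h2
  calc |torusE G r β L (plane G r q x) - torusE G r β L' (plane G r q 0)|
      ≤ |torusE G r β L (plane G r q x) - kerE G r β (fun k => x k - (R + 1)) (2 * R + 3) η (plane G r q x)| +
          |kerE G r β (fun k => x k - (R + 1)) (2 * R + 3) η (plane G r q x) - torusE G r β L' (plane G r q 0)| :=
        abs_sub_le _ _ _
    _ ≤ C / (R : ℝ) ^ 4 + C / (R : ℝ) ^ 4 := add_le_add (by rw [abs_sub_comm]; exact h1) h2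
    _ = 2 * C / (R : ℝ) ^ 4 := by ring

end KernelSide

/-! ## §2 The infinite-volume plaquette mean at strong coupling (odd tori) -/

section ThermodynamicLimit

/-- **The plaquette means converge in the volume at strong coupling, at rate `R⁻⁴`, to a site-independent limit.**  There
are `β₀ > 0` and `C ≥ 0` such that for `|β| < β₀` and every orientation `q` there is `P` with
`⟨plane q 0⟩_{2L+1,β} → P` as `L → ∞` and `|⟨plane q x⟩_{2L+1,β} − P| ≤ 2C/R⁴` for every site `x`, `1 ≤ R`, `R + 2 ≤ L`;
moreover `|P| ≤ sup|plane|`.  Proof: §1 makes `L ↦ ⟨plane q 0⟩_{2L+1,β}` Cauchy; `ℝ` is complete; pass to the limit in §1.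
[folklore: Osterwalder–Seiler (1978) §4 regime] -/
theorem exists_tendsto_torusE_plane_smallBeta {CA : ℝ}
    (hCA : ∀ (q : Fin 4 × Fin 4) (x : Fin 4 → ℤ) (U : LGConfig 4 G), |plane G r q x U| ≤ CA) :
    ∃ β₀ : ℝ, 0 < β₀ ∧ ∃ C : ℝ, 0 ≤ C ∧ ∀ β : ℝ, |β| < β₀ → ∀ q : Fin 4 × Fin 4, ∃ P : ℝ,
      Tendsto (fun L : ℕ => torusE G r β L (plane G r q 0)) atTop (𝓝 P) ∧ |P| ≤ CA ∧
      ∀ (x : Fin 4 → ℤ) (R L : ℕ), 1 ≤ R → R + 2 ≤ L →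
        |torusE G r β L (plane G r q x) - P| ≤ 2 * C / (R : ℝ) ^ 4 := by
  obtain ⟨β₀, hβ₀, C, hC, H⟩ := abs_torusE_plane_sub_torusE_plane_zero_le_smallBeta r
  refine ⟨β₀, hβ₀, C, hC, fun β hβ q => ?_⟩
  set u : ℕ → ℝ := fun L => torusE G r β L (plane G r q 0) with hu
  -- Cauchy in the volume
  have hcau : CauchySeq u := by
    refine Metric.cauchySeq_iff'.2 fun ε hε => ?_
    obtain ⟨R, hR⟩ := exists_nat_gt (2 * C / ε + 1)
    have hR1 : 1 ≤ R := by
      have : (1 : ℝ) < R := by linarith [div_nonneg (by positivity : (0 : ℝ) ≤ 2 * C) hε.le]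
      exact_mod_cast this.le
    have hR0 : (0 : ℝ) < R := by exact_mod_cast (show 0 < R by omega)
    refine ⟨R + 2, fun n hn => ?_⟩
    rw [Real.dist_eq]
    have h1 := H β hβ q 0 R n (R + 2) hR1 (by omega) le_rfl
    have h2 : 2 * C / (R : ℝ) ^ 4 ≤ 2 * C / (R : ℝ) := by
      refine div_le_div_of_nonneg_left (by positivity) hR0 ?_
      calc (R : ℝ) = (R : ℝ) ^ 1 := (pow_one _).symm
        _ ≤ (R : ℝ) ^ 4 := pow_le_pow_right₀ (by exact_mod_cast hR1) (by norm_num)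
    have h3 : 2 * C / (R : ℝ) < ε := by
      rw [div_lt_iff₀ hR0]
      have : 2 * C / ε < R := by linarith
      rw [div_lt_iff₀ hε] at this
      linarith
    exact lt_of_le_of_lt (h1.trans h2) h3
  obtain ⟨P, hP⟩ := cauchySeq_tendsto_of_complete hcau
  -- the rate bound for every site, and the sup bound, by passing to the limit
  have hrate : ∀ (x : Fin 4 → ℤ) (R L : ℕ), 1 ≤ R → R + 2 ≤ L →
      |torusE G r β L (plane G r q x) - P| ≤ 2 * C / (R : ℝ) ^ 4 := by
    intro x R L hR hL
    have hlim : Tendsto (fun L' : ℕ => |torusE G r β L (plane G r q x) - u L'|) atTop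
        (𝓝 |torusE G r β L (plane G r q x) - P|) := (tendsto_const_nhds.sub hP).abs
    exact le_of_tendsto hlim (Filter.eventually_atTop.2 ⟨R + 2, fun L' hL' => H β hβ q x R L L' hR hL hL'⟩)
  have hsup : |P| ≤ CA :=
    le_of_tendsto hP.abs (Filter.Eventually.of_forall fun L => abs_torusE_sub_le_of_forall r β L
      (continuous_plane r q 0) (c := 0) (h := CA) (fun U => by rw [sub_zero]; exact hCA q 0 U) |>.trans_eq' (by
        rw [sub_zero]))
  exact ⟨P, hP, hsup, hrate⟩

end ThermodynamicLimit

/-! ## §3 The body of (RM) at strong coupling -/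

section Body

/-- **The body of the response-moment binder holds at strong coupling, on every odd torus.**  For every `C₁ > 0` there
are `β₀ > 0`, `B` (`= 3C/C₁`), `P₀` and reference values `p q β` depending on the orientation and the coupling ONLY
(`|p| ≤ P₀`; for `|β| < β₀` the infinite-volume plaquette mean of §2) such that for `|β| < β₀`, every odd torus
`(ℤ/(2L+1))⁴`, every `n`, orientations `q i`, sites `x i`, radius `R` with `1 ≤ R`, `4R+8 ≤ L`, and EVERY index set `T`:
`⟨exp(Σ_{i∈T} (R⁴/C₁)|kerE_{x i−(R+1),2R+3}(plane (q i) (x i)) − p (q i) β|)⟩_{2L+1,β} ≤ exp(B·#T)` — the body of (RM)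
verbatim (no separation, orientation or unit hypothesis is needed in this regime).  Proof: every exterior responds within
`C/R⁴` of the torus mean (§1) ⇒ the centred exponent is `≤ (C/C₁)·#T` pointwise; the means are within `2C/R⁴` of `p` (§2)
⇒ recentring costs `2C/C₁` per member (`torusE_exp_sum_response_recentre`). [folklore: Osterwalder–Seiler (1978) §4 regime;
Dobrushin–Shlosman (1985) via p529847] -/
theorem responseMoments_body_smallBeta {C₁ : ℝ} (hC₁ : 0 < C₁) :
    ∃ β₀ : ℝ, 0 < β₀ ∧ ∃ (B P₀ : ℝ) (p : Fin 4 × Fin 4 → ℝ → ℝ), (∀ q β, |p q β| ≤ P₀) ∧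
      ∀ β : ℝ, |β| < β₀ → ∀ (L n : ℕ) (q : Fin n → Fin 4 × Fin 4) (x : Fin n → (Fin 4 → ℤ)) (R : ℕ),
        1 ≤ R → 4 * R + 8 ≤ L → ∀ T : Finset (Fin n),
        torusE G r β L (fun U => Real.exp (∑ i ∈ T, (R : ℝ) ^ 4 / C₁ *
          |kerE G r β (fun k => x i k - (R + 1)) (2 * R + 3) U (plane G r (q i) (x i)) - p (q i) β|)) ≤
          Real.exp (B * T.card) := by
  obtain ⟨CA, hCA⟩ := exists_abs_plane_le (G := G) r
  have hCA0 : 0 ≤ CA := (abs_nonneg _).trans (hCA (0, 1) 0 (fun _ => 1))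
  obtain ⟨β₀, hβ₀, C, hC, Hker⟩ := abs_kerE_sub_torusE_plane_le_smallBeta r
  obtain ⟨β₀', hβ₀', C', hC', Hlim⟩ := exists_tendsto_torusE_plane_smallBeta r hCA
  -- the reference values: the infinite-volume means inside the regime, `0` outside
  classical
  let p : Fin 4 × Fin 4 → ℝ → ℝ := fun q β =>
    if h : |β| < β₀' then Classical.choose (Hlim β h q) else 0
  have hp_spec : ∀ (q : Fin 4 × Fin 4) (β : ℝ) (h : |β| < β₀'), |p q β| ≤ CA ∧
      ∀ (x : Fin 4 → ℤ) (R L : ℕ), 1 ≤ R → R + 2 ≤ L →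
        |torusE G r β L (plane G r q x) - p q β| ≤ 2 * C' / (R : ℝ) ^ 4 := by
    intro q β h
    have hs := Classical.choose_spec (Hlim β h q)
    simp only [p, dif_pos h]
    exact ⟨hs.2.1, hs.2.2⟩
  refine ⟨min β₀ β₀', lt_min hβ₀ hβ₀', C / C₁ + 2 * C' / C₁, CA, p, fun q β => ?_, ?_⟩
  · by_cases h : |β| < β₀'
    · exact (hp_spec q β h).1
    · simp only [p, dif_neg h, abs_zero]; exact hCA0
  intro β hβ L n q x R hR hRL T
  have hβ1 : |β| < β₀ := lt_of_lt_of_le hβ (min_le_left _ _)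
  have hβ2 : |β| < β₀' := lt_of_lt_of_le hβ (min_le_right _ _)
  have hR0 : (0 : ℝ) < R := by exact_mod_cast (show 0 < R by omega)
  have hRL' : R + 2 ≤ L := by omega
  -- (i) centred at the torus means: the exponent is at most `(C/C₁)·#T` pointwise
  set m : Fin n → ℝ := fun i => torusE G r β L (plane G r (q i) (x i)) with hm
  have hpt : ∀ U : LGConfig 4 G, Real.exp (∑ i ∈ T, (R : ℝ) ^ 4 / C₁ *
      |kerE G r β (fun k => x i k - (R + 1)) (2 * R + 3) U (plane G r (q i) (x i)) - m i|) ≤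
        Real.exp (C / C₁ * T.card) := fun U => by
    refine Real.exp_le_exp.2 ?_
    have hterm : ∀ i ∈ T, (R : ℝ) ^ 4 / C₁ *
        |kerE G r β (fun k => x i k - (R + 1)) (2 * R + 3) U (plane G r (q i) (x i)) - m i| ≤ C / C₁ := by
      intro i _
      have h := Hker β hβ1 (q i) (x i) R L hR hRL' U
      calc (R : ℝ) ^ 4 / C₁ * |kerE G r β (fun k => x i k - (R + 1)) (2 * R + 3) U (plane G r (q i) (x i)) - m i|
          ≤ (R : ℝ) ^ 4 / C₁ * (C / (R : ℝ) ^ 4) := mul_le_mul_of_nonneg_left h (by positivity)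
        _ = C / C₁ := by field_simp
    calc ∑ i ∈ T, (R : ℝ) ^ 4 / C₁ *
          |kerE G r β (fun k => x i k - (R + 1)) (2 * R + 3) U (plane G r (q i) (x i)) - m i|
        ≤ ∑ i ∈ T, C / C₁ := Finset.sum_le_sum hterm
      _ = C / C₁ * T.card := by rw [Finset.sum_const, nsmul_eq_mul]; ring
  have hcen : torusE G r β L (fun U => Real.exp (∑ i ∈ T, (R : ℝ) ^ 4 / C₁ *
      |kerE G r β (fun k => x i k - (R + 1)) (2 * R + 3) U (plane G r (q i) (x i)) - m i|)) ≤
        Real.exp (C / C₁ * T.card) := by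
    calc _ ≤ torusE G r β L (fun _ => Real.exp (C / C₁ * T.card)) :=
          torusE_mono r β L (continuous_exp_sum_response r β T q x R _ _) continuous_const hpt
      _ = Real.exp (C / C₁ * T.card) := torusE_const r β L _
  -- (ii) recentring at the `L`-independent reference values costs `2C'/C₁` per member
  have hclose : ∀ i ∈ T, |m i - p (q i) β| ≤ 2 * C' / (R : ℝ) ^ 4 := fun i _ =>
    (hp_spec (q i) β hβ2).2 (x i) R L hR hRL'
  have hδ : (R : ℝ) ^ 4 / C₁ * (2 * C' / (R : ℝ) ^ 4) * T.card = 2 * C' / C₁ * T.card := by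
    field_simp
  calc _ ≤ Real.exp ((R : ℝ) ^ 4 / C₁ * (2 * C' / (R : ℝ) ^ 4) * T.card) *
          torusE G r β L (fun U => Real.exp (∑ i ∈ T, (R : ℝ) ^ 4 / C₁ *
            |kerE G r β (fun k => x i k - (R + 1)) (2 * R + 3) U (plane G r (q i) (x i)) - m i|)) :=
        torusE_exp_sum_response_recentre r β L T q x R hC₁ m (fun i => p (q i) β) hclose
    _ ≤ Real.exp (2 * C' / C₁ * T.card) * Real.exp (C / C₁ * T.card) := by
        rw [hδ]
        exact mul_le_mul_of_nonneg_left hcen (Real.exp_nonneg _)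
    _ = Real.exp ((C / C₁ + 2 * C' / C₁) * T.card) := by rw [← Real.exp_add]; ring_nf

end Body

/-! ## §4 The same read at `SU(2)`, fundamental representation (the registered stub's group and representation) -/

section Named

/-- **The body of `ResponseMomentsOdd6SU2` at strong coupling.**  For `SU(2)` with its Borel structure and the
fundamental lattice representation there are `β₀ > 0`, `C₁ > 0`, `B`, `P₀` and `L`-, `R`-independent reference values `p`
(`|p| ≤ P₀`) such that for `|β| < β₀` the conclusion of the registered stub `stub_responseMomentsOdd6` after its window
clause holds VERBATIM with «`|β| < β₀`» for «`β₁ ≤ β`» (and without needing the unit guard, the orientation or the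
separation hypotheses).  A format rung: the v5(α) currency is inhabited by the Wilson state at high temperature; nothing
about `β → ∞`. [folklore: Osterwalder–Seiler (1978) §4 regime] -/
theorem responseMomentsOdd6SU2_body_smallBeta :
    letI : MeasurableSpace (Matrix.specialUnitaryGroup (Fin 2) ℂ) := borel _
    haveI : BorelSpace (Matrix.specialUnitaryGroup (Fin 2) ℂ) := ⟨rfl⟩
    ∃ β₀ : ℝ, 0 < β₀ ∧ ∃ (C₁ B P₀ : ℝ) (p : Fin 4 × Fin 4 → ℝ → ℝ), 0 < C₁ ∧ (∀ q β, |p q β| ≤ P₀) ∧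
      ∀ β : ℝ, |β| < β₀ → ∀ (L n : ℕ) (q : Fin n → Fin 4 × Fin 4) (x : Fin n → (Fin 4 → ℤ)) (R : ℕ),
        1 ≤ R → 4 * R + 8 ≤ L → ∀ T : Finset (Fin n),
        torusE (Matrix.specialUnitaryGroup (Fin 2) ℂ) (fundamentalLatticeRep 2) β L
          (fun U => Real.exp (∑ i ∈ T, (R : ℝ) ^ 4 / C₁ *
            |kerE (Matrix.specialUnitaryGroup (Fin 2) ℂ) (fundamentalLatticeRep 2) β
              (fun k => x i k - (R + 1)) (2 * R + 3) U
              (plane (Matrix.specialUnitaryGroup (Fin 2) ℂ) (fundamentalLatticeRep 2) (q i) (x i)) -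
              p (q i) β|)) ≤ Real.exp (B * T.card) := by
  letI : MeasurableSpace (Matrix.specialUnitaryGroup (Fin 2) ℂ) := borel _
  haveI : BorelSpace (Matrix.specialUnitaryGroup (Fin 2) ℂ) := ⟨rfl⟩
  obtain ⟨β₀, hβ₀, B, P₀, p, hp, H⟩ :=
    responseMoments_body_smallBeta (fundamentalLatticeRep 2 : LatticeRep (Matrix.specialUnitaryGroup (Fin 2) ℂ))
      one_pos
  exact ⟨β₀, hβ₀, 1, B, P₀, p, one_pos, hp, H⟩

end Named

end Summit.QuantumFields.YangMills.Cruxes.UVSeamRec.ResponsePinning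

end
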